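import Mathlib
import Summits.Ventures.HodgeRepro2.T5LocalNormCharacter

/-!
# `η_v(−1)` at the non-split places: `η_v(−1) = −1 ⟺ q_v ≡ 3 (mod 4)` at a tamely ramified place

`Kv ⊆ Lw` Mathlib's completions, `[Lw : Kv] = 2`, `σ ≠ 1`, `η_v = normChar v w σ hind` the local
norm character of `T5LocalNormCharacter` (`hind : (normGroup v w σ).index = 2`), `k = 𝓀(O_Kv)` the
residue field and `q_v = |k|`.

* INERT (`alg ϖ` irreducible): `normChar_neg_one_eq_one` — `−1` is a unit, hence a norm;
* TAMELY RAMIFIED (`2 ∈ O_Kvˣ`): `neg_one_mem_normGroup_iff` — `−1` is a norm iff `−1` is a square in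
  `k` (the unit criterion of `T5TameRamifiedNormGroup`) iff `q_v ≢ 3 (mod 4)` (Mathlib
  `FiniteField.isSquare_neg_one_iff`); **`normChar_neg_one_eq_neg_one_iff : η_v(−1) = −1 ⟺ q_v % 4 = 3`**,
  `normChar_neg_one_eq_one_iff`.

This is the parenthetical «`η_v(−1) = −1` (tame: `q_v ≡ 3 mod 4`)» of route/TIER5.md §N5.12 (the set
`S_γ` of the narrowed datum condition (D-ξ_A)) and the sign `ε_δ(W) = η_v(−1)` of CHECK-N5 Δ1, in
kernel. The finite-field input is Mathlib's `FiniteField.isSquare_neg_one_iff` (`−1` is a square in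
`𝔽_q` iff `q ≢ 3 (mod 4)`); cf. Serre, *Local Fields*, Ch. XIV §4 (the symbol `(a, b)_p` for `ℚ_p`,
`n = 2`: `(−1, p)_p = (−1)^{(p−1)/2}`, the formula at the head of the section).

Declaration per README §8(d): «uses an L-value-free non-vanishing device: NO».
-/

namespace Summit.Ventures.HodgeRepro2.T5TameNormCharNegOne

open IsDedekindDomain HeightOneSpectrum IsLocalRing WithZero T5AdicCompletionNormGroup
  T5LocalNormCharacter

variable {K : Type*} [Field K] [NumberField K] (v : HeightOneSpectrum (NumberField.RingOfIntegers K))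

/-- `v (−1) = 1`. -/
theorem val_neg_one : Valued.v (((-1 : (adicCompletion K v)ˣ) : adicCompletion K v)) = 1 := by
  rw [Units.val_neg, Units.val_one, Valuation.map_neg, map_one]

/-- The residue of `−1 ∈ O_Kv` is `−1`. -/
theorem residue_neg_one_eq :
    residue (adicCompletionIntegers K v)
      ⟨((-1 : (adicCompletion K v)ˣ) : adicCompletion K v),
        (mem_adicCompletionIntegers _ _ _).mpr (val_neg_one v).le⟩ = -1 := by
  have e : (⟨((-1 : (adicCompletion K v)ˣ) : adicCompletion K v),
      (mem_adicCompletionIntegers _ _ _).mpr (val_neg_one v).le⟩ : adicCompletionIntegers K v) = -1 :=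
    Subtype.ext (by simp)
  rw [e, map_neg, map_one]

variable {L : Type*} [Field L] [NumberField L] [Algebra K L]
  (w : HeightOneSpectrum (NumberField.RingOfIntegers L)) [w.asIdeal.LiesOver v.asIdeal]
  (σ : Gal(adicCompletion L w/adicCompletion K v)) (hind : (normGroup v w σ).index = 2)
  (h2 : Module.finrank (adicCompletion K v) (adicCompletion L w) = 2)
  {ϖ : adicCompletionIntegers K v} (hϖ : Irreducible ϖ)

section Inert

variable (hϖS : Irreducible (algebraMap (adicCompletionIntegers K v) (adicCompletionIntegers L w) ϖ))
  (hσ : σ ≠ 1)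

include h2 hϖ hϖS hσ in
/-- INERT: `η_v(−1) = 1` (`−1` is a unit). -/
theorem normChar_neg_one_eq_one : normChar v w σ hind (-1) = 1 :=
  normChar_eq_one_of_val_eq_one v w σ hind h2 hϖ hϖS hσ (val_neg_one v)

end Inert

section TameRamified

variable {π : adicCompletionIntegers L w} (hπ : Irreducible π)
  (hram : ¬ Irreducible (algebraMap (adicCompletionIntegers K v) (adicCompletionIntegers L w) ϖ))
  (hσ : σ ≠ 1) (h2u : IsUnit (2 : adicCompletionIntegers K v))

include h2 hϖ hπ hram hσ h2u in
/-- TAMELY RAMIFIED: `−1` is a norm from `Lw` iff `q_v ≢ 3 (mod 4)`. -/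
theorem neg_one_mem_normGroup_iff :
    (-1 : (adicCompletion K v)ˣ) ∈ normGroup v w σ ↔
      Nat.card (ResidueField (adicCompletionIntegers K v)) % 4 ≠ 3 := by
  rw [T5TameRamifiedNormGroup.mem_normGroup_iff_isSquare_residue v w σ h2 hϖ hπ hram hσ h2u (-1)
    (val_neg_one v), residue_neg_one_eq v]
  haveI : Fintype (ResidueField (adicCompletionIntegers K v)) := Fintype.ofFinite _
  rw [Nat.card_eq_fintype_card]
  exact FiniteField.isSquare_neg_one_iff

include h2 hϖ hπ hram hσ h2u in
/-- TAMELY RAMIFIED: `η_v(−1) = 1 ⟺ q_v ≢ 3 (mod 4)`. -/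
theorem normChar_neg_one_eq_one_iff :
    normChar v w σ hind (-1) = 1 ↔ Nat.card (ResidueField (adicCompletionIntegers K v)) % 4 ≠ 3 := by
  rw [normChar_eq_one_iff, neg_one_mem_normGroup_iff v w σ h2 hϖ hπ hram hσ h2u]

include h2 hϖ hπ hram hσ h2u in
/-- TAMELY RAMIFIED: `η_v(−1) = −1 ⟺ q_v ≡ 3 (mod 4)` — the tame description of the set `S_γ`. -/
theorem normChar_neg_one_eq_neg_one_iff :
    normChar v w σ hind (-1) = -1 ↔ Nat.card (ResidueField (adicCompletionIntegers K v)) % 4 = 3 := by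
  rw [normChar_eq_neg_one_iff, neg_one_mem_normGroup_iff v w σ h2 hϖ hπ hram hσ h2u, not_not]

end TameRamified

end Summit.Ventures.HodgeRepro2.T5TameNormCharNegOne
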